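import Summits.HodgeConjecture.HodgeConjecture.Cruxes.BlochSeedDiscOne.ShellThreePairLaw
import Summits.HodgeConjecture.HodgeConjecture.Cruxes.BlochSeedDiscOne.DeepLayerLaws
import Summits.HodgeConjecture.HodgeConjecture.Cruxes.BlochSeedDiscOne.PhaseTorusBoxLaw

/-!
# The AXIS-ROOM PHASE-TORUS LAW in the door of record — flow-free, every height, budget-free (strengthen g19, v1.3)

HONESTY LABEL. Nothing in this file is a theorem toward HC / HC_CM / HC_AV / №4 / 26512 / 18881 / H2, and it closes no shell of
`SPlus 14 sigmaH 0`. It is a kernel-checked LAW about the two-term letter designs of `DepthBoundA4` (the objects of the S⁺ sentence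
`RuleDPlate.SPlusB`), offered as evidence for the strengthen lens: an S⁺ whose proof is a FINITE LETTER CALCULUS on the phase torus
`(ℤ/4)⁴`, in the vocabulary of the door of record (`Design`, hubs, weak arrows, `HallUp`, `HallPlusUp 8`) and with NO flow data.

THE ROOM. `AxisRoom D`: every supported letter is an AXIS letter (`x·y = 0`: the hub `o`, or `β ∈ {±c, ±c·i}`); hub-bearing cells are
allowed on both sides.  Everything is proved in the RELAXED room `AxisRoomHF D` — only the HUB-FREE support cells need be axis cells,
hub-bearing support cells are arbitrary — from the single room datum `E_h(D) = 0`, which holds in `AxisRoom` (pair law) and more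
generally whenever ONE slot pair is never doubly off-axis on the support (§9, `pairAxis_mu_eq_zero`). (The LINE designs of record — supports `S′` (LINE 14), `S131` (LINE 16) — live in rooms of this kind; the
MConfig law `LinePhaseTorus.lineTwoTermUp7_mu_eq_zero` treated the hub-free case with the up-flow GIVEN AS DATA and `rank ≤ 7`.)

THE LAW (kernel, 0 sorry):
* `axisRoom_mu_eq_zero` — on the height-`h` alphabet (every `h`), `AxisRoom D → D.A1 → HallPlusUp D 8 → D.rank ≤ 18 → D.mu = 0`;
  no budget, no `RuleD`, no `Disj`, not even `HallUp`, and no flow.  Contrapositive `axisRoom_rank_ge_nineteen`: an axis-room inhabitant of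
  the door of record has `rank ≥ 19`; room-of-record reading `sPlusB_axisRoom_rank_le` (every shell, every budget).
* `axisRoom_inhabitant_shape` — `μ ≠ 0` in the axis room of the door forces ≥ 11 POSITIVE classes, ≥ 11 NEGATIVE classes of the class
  measure `ω` below, and `#{ω > 0} + 8 ≤ rank`; `posCl_empty_or_cost` — THE SURPLUS DICHOTOMY: `{ω > 0} = ∅` or `#{ω > 0} + 8 ≤ rank`.
* `axisRoom_mu_eq_zero_of_rank_le_ten` — `AxisRoom D → D.A1 → HallUp D → D.rank ≤ 10 → D.mu = 0` (the Design-level, flow-free form of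
  the MConfig law, corank 10 in place of 7).
* `axisRoom_mu_eq_zero_of_effective` — an (A1)-clean axis-room design with NO P-mass has `μ = 0` at EVERY rank and height, with no
  Hall condition (`E = 0` forces a hub in every supported cell).
* `axisRoom_mu_eq_zero_of_law` — THE METHOD CEILING typed: any corank-`γ` torus law gives `rank ≤ γ + 8 ⇒ μ = 0`; the kernel window
  `10 ≤ γ* ≤ 13` (`PhaseTorusBoxLaw.phaseTorusLawN_ten`, `PhaseTorusLawN14.not_phaseTorusLawN_fourteen`) caps this road at `rank ≤ 21`.
* the structural exports `axisRoom_posClasses`: `#{ω > 0} ≤ rank` under `HallUp`, and `#{ω > 0} + 8 ≤ rank` under `HallPlusUp 8` as soon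
  as one supported P-cell carries a hub (`card_add_eight_le_rank_of_exc_pos`: as soon as positive P-mass lies outside the class union).
* §8, THE UP-CLOSED MIRROR (`sum_lexc_le`, `sum_lexc_add_eight_le`): hub-bearing cells plus the LOWER class sets `{V ≤ t_τ}` are closed
  upward, so lower P-excesses and P-hubs are paid for by hub-bearing N-mass: `Σ_{τ∈B} (m(P_τ ∩ {V ≤ t_τ}) − n(N_τ ∩ {V ≤ t_τ})) ≤ hubN − hubP`
  (`− 8` under `HallPlusUp 8` once the up-set carries P-mass); `hubP + 8 ≤ hubN` once a P-cell carries a hub (`hubP_add_eight_le_hubN`);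
  and CLASSWISE LOWER DOMINATION when the N-side is hub-free (`lexc_nonpos_of_hubN_eq_zero`, `hubP_eq_zero_of_hubN_eq_zero`).
* §9, `E = 0` BEYOND THE AXIS ROOM (`E_eq_zero_of_pairAxisRoom`, `E_eq_zero_of_nearAxisRoom`): one slot pair never simultaneously
  off-axis on the support already forces `E_h(D) = 0` (the exact extent of the pair law's vanishing; the torus dictionary needs the full
  axis room).

THE CALCULUS (each step a named theorem):
1. SLIDE LEMMA `slide` / `slide_cell`: a weak (not-dead) arrow from a hub-free axis cell `x` down to a supported axis cell `y` keeps the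
   phase class `cphase` slotwise and has `V y ≤ V x` (`V = ∏ colevel`); the key inequality is `(|x|+|y|)(|x′|+|y′|) ≤ xx′+yy′` from
   `q(β′−β) ≤ (a′−a)²` and `xy = 0`.  Hence every class down-set `{hub-free, cphase ∈ A, V ≥ t(cphase)}` is `DownClosedOn D`
   (`downClosedOn_inClass`).
2. HALL DOWN-CUTS (`DeepLayerLaws.hallUp_down_cut`, `hallPlusUp_down_cut`): the N-mass of a down-closed set is at most its P-mass `+ rank`
   (`+ rank − 8` when positive P-mass lies outside).  Summed over classes: `Σ_{τ∈A} exc(τ, t_τ) ≤ rank (− 8)`, `exc = massN − massP` of the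
   class down-set (`card_le_rank_of_exc_pos`, `card_add_eight_le_rank_of_exc_pos`).
3. LAYER CAKE (`omegaC_eq_sum_exc`): the class measure `ω(τ) = (Σ_N − Σ_P) m·V·[hub-free, class τ]` is `Σ_{s ≥ 1} exc(τ, s)`, so a
   positive class has a threshold of positive excess (`exists_exc_pos`) and POSITIVE CLASSES COST RANK (`posClasses_card_le_rank`,
   `posClasses_card_add_eight_le_rank`).
4. TOTAL MASS (`sum_omegaC_eq_E`, `E_eq_zero_of_axisRoom`): `Σ_τ ω(τ) = E_h(D)` (the depth functional of `RingTwoMassLaw`), and `E = 0`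
   in the axis room by the PAIR LAW `E = 4·(pair-weight mass)` of `ShellThreePairLaw` (axis letters have pair weight `0`).
5. MOMENT DICTIONARY (`moment_omegaR`, `slot_bridge`: `c·i^{k·phase} = dval (pat k)`, i.e. `k_f = 0 ↦ h − a`, `1 ↦ β`, `3 ↦ β̄`): every
   Fourier coefficient `ω̂(k)` with no `2` in `k` is a decorated e-row `(Σ_N − Σ_P) m·∏_f dval`, hence `0` for admissible `k ≠ 0` by the
   DECORATED e-ROW LAW ((A1) clause 1, `ShellThreePairLaw.decorated_row_law`), `ω̂(0) = E = 0` by step 4, and `ω̂(1111) = μ̄` (`T_EEEE`).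
6. PHASE-TORUS LAW at corank 10 (`PhaseTorusBoxLaw.phaseTorusLawN_ten`: box law + E8 law + double counting; corank 7 was the 65 536-case
   certificate `phaseTorusLaw7_holds`): a real function on `(ℤ/4)⁴` with vanishing admissible moments and at most TEN positive points has
   top coefficient `0`; so `μ = 0` once `#{ω > 0} ≤ 10` (`mu_eq_zero_of_few_posClasses`) — and, applied to `−ω`, once `#{ω < 0} ≤ 10`
   (`mu_eq_zero_of_few_negClasses`).
7. SURPLUS DICHOTOMY (`posCl_empty_or_cost`) and HEADLINE (`axisRoom_mu_eq_zero`): either some positive P-mass lies outside the union of the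
   positive classes' threshold down-sets — then `#{ω > 0} + 8 ≤ rank` — or all of P lies inside, every class outside `{ω > 0}` has
   `ω ≥ 0`, hence `= 0`, and `0 = E = Σ_τ ω(τ) ≥ #{ω > 0}` forces `{ω > 0} = ∅`; so `μ ≠ 0 ⇒ 11 ≤ #{ω > 0} ≤ rank − 8`.

THE S⁺ CANDIDATE THIS TYPES (strengthen brief: «find the S⁺ whose inductive step is a finite letter calculus like the PHASE-TORUS proof»):
`S⁺_AXIS(r)`: «no (A1)-clean `μ ≠ 0` axis-room design passing `HallPlusUp 8` with `rank ≤ r`», at EVERY height and with no budget — the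
inductive parameter is the number of positive phase classes, traded against rank by the Hall down-cuts.  PROVED here for `r = 18`
(and `r = 10` from `HallUp` alone).  NAMED GAP: `r ≥ 19` — the surplus `8` is spent once and the torus law is spent at corank 10; the
step `r ↦ r + 8` needs a second, disjoint surplus (two hub-bearing P-cells whose up-cones do not meet inside the class union), and
`r > 21` needs an input outside this method family (`axisRoom_mu_eq_zero_of_law` + `not_phaseTorusLawN_fourteen`): integrality and
REALISABILITY of `ω` as a class measure (the corank-14 torus witness need not be one), or the other door binders (`RuleD`, budget).
What it does NOT do: it says nothing about designs with an off-axis support letter (rings B/D of shell 3 and beyond), where `E ≠ 0` and the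
class measure acquires the pair-weight term; the cell's shell-3 programme (pen binders (M1)(M2)(M4) + SAT cover) is the road there.
(Re-committed unchanged by strengthen g20 to refresh the farm build; the corank-13 corollaries live in `AxisPhaseTorus21.lean`.)
-/

set_option linter.dupNamespace false
set_option autoImplicit false

namespace Summit.HodgeConjecture.HodgeConjecture.Cruxes.BlochSeedDiscOne.AxisPhaseTorus

open Summit.HodgeConjecture.HodgeConjecture.Cruxes.BlochSeedDiscOne.DepthBoundA4
open Summit.HodgeConjecture.HodgeConjecture.Cruxes.BlochSeedDiscOne.DeepLayerLaws
  (DownClosedOn UpClosedOn massOn hallUp_down_cut hallPlusUp_down_cut hallUp_cut_on hallPlusUp_cut_on colevel_eq_of_onAlphabet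
    colevel_nonneg colevel_pos_iff colevel_eq_zero_iff)
open Summit.HodgeConjecture.HodgeConjecture.Cruxes.BlochSeedDiscOne.HallB136 (HallUp)
open Summit.HodgeConjecture.HodgeConjecture.Cruxes.BlochSeedDiscOne.RuleDPlate (HallPlusUp)
open Summit.HodgeConjecture.HodgeConjecture.Cruxes.BlochSeedDiscOne.RingTwoMassLaw (linZ_congr')
open Summit.HodgeConjecture.HodgeConjecture.Cruxes.BlochSeedDiscOne.RingTwoMassLaw.CI (A1e a1e_of_a1 wsum wsum_cons wsum_nil T_eq_wsum)
open Summit.HodgeConjecture.HodgeConjecture.Cruxes.BlochSeedDiscOne.RingTwoMassLaw.ClassLaw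
-- used from `ShellThreePairLaw`: `pair_law_alphabet`, `pw`, `DS`, `dval`, `decorated_row_law`, `linZ_eq_zero_of_vanish`
open Summit.HodgeConjecture.HodgeConjecture.Cruxes.BlochSeedDiscOne.ShellThreePairLaw
open Summit.HodgeConjecture.HodgeConjecture.Cruxes.BlochSeedDiscOne.PhaseTorus
  (PT chi moment KAdm PhaseTorusLawN phaseTorusLaw7_holds phaseTorusLawN_ten e e_three_mul chi_eq_prod_e zmod4_cases)

/-! ## §1 Axis letters: the phase and the SLIDE LEMMA for weak arrows -/

/-- the phase of an axis letter, `β = c·i^{phase}`: `x > 0 ↦ 0`, `y > 0 ↦ 1`, `x < 0 ↦ 2`, `y < 0 ↦ 3` (immaterial at the hub). -/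
def phase (ℓ : Letter) : ZMod 4 :=
  if 0 < ℓ.x then 0 else if 0 < ℓ.y then 1 else if ℓ.x < 0 then 2 else 3

theorem abs_mul_abs_eq_zero_of_isAxis {ℓ : Letter} (h : ℓ.isAxis) : |ℓ.x| * |ℓ.y| = 0 := by
  rw [← abs_mul]; unfold Letter.isAxis at h; rw [h, abs_zero]

/-- **THE SLIDE LEMMA.** On the height-`h` alphabet, a weak (not-dead) step `ℓ → ℓ'` between AXIS letters with `ℓ'` charged keeps the
phase and does not increase the co-level: the weak cone below a charged axis letter is its own ray. (Below the hub everything is allowed.) -/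
theorem slide {h : ℤ} {ℓ ℓ' : Letter} (hℓ : ℓ.OnAlphabet h) (hℓ' : ℓ'.OnAlphabet h) (hax : ℓ.isAxis) (hax' : ℓ'.isAxis)
    (hc : 0 < ℓ'.colevel) (hnd : NotDead ℓ ℓ') : phase ℓ = phase ℓ' ∧ ℓ'.colevel ≤ ℓ.colevel := by
  rcases hnd with e | ⟨ha, hq⟩
  · subst e; exact ⟨rfl, le_rfl⟩
  have e1 : ℓ.colevel = h - ℓ.a := colevel_eq_of_onAlphabet hℓ
  have e2 : ℓ'.colevel = h - ℓ'.a := colevel_eq_of_onAlphabet hℓ'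
  refine ⟨?_, by omega⟩
  have h0 := abs_mul_abs_eq_zero_of_isAxis hax
  have h0' := abs_mul_abs_eq_zero_of_isAxis hax'
  unfold Letter.colevel at e1 e2 hc
  have hda : ℓ'.a - ℓ.a = (|ℓ.x| + |ℓ.y|) - (|ℓ'.x| + |ℓ'.y|) := by omega
  rw [hda] at hq
  have hxx : ℓ.x * ℓ'.x ≤ |ℓ.x| * |ℓ'.x| := by rw [← abs_mul]; exact le_abs_self _
  have hyy : ℓ.y * ℓ'.y ≤ |ℓ.y| * |ℓ'.y| := by rw [← abs_mul]; exact le_abs_self _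
  have key : (|ℓ.x| + |ℓ.y|) * (|ℓ'.x| + |ℓ'.y|) ≤ ℓ.x * ℓ'.x + ℓ.y * ℓ'.y := by
    nlinarith [sq_abs ℓ.x, sq_abs ℓ.y, sq_abs ℓ'.x, sq_abs ℓ'.y]
  have hxn := abs_nonneg ℓ.x
  have hyn := abs_nonneg ℓ.y
  have hxn' := abs_nonneg ℓ'.x
  have hyn' := abs_nonneg ℓ'.y
  have cross1 : |ℓ.x| * |ℓ'.y| = 0 := by nlinarith
  have cross2 : |ℓ.y| * |ℓ'.x| = 0 := by nlinarith
  have hpos : 0 < ℓ.x * ℓ'.x + ℓ.y * ℓ'.y := by nlinarith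
  unfold Letter.isAxis at hax hax'
  rcases mul_eq_zero.mp hax' with hx' | hy'
  · -- `ℓ'` on the y-axis
    have hy'ne : ℓ'.y ≠ 0 := by
      intro hy'; rw [hx', hy'] at hc; simp at hc
    have hx : ℓ.x = 0 := by
      rcases mul_eq_zero.mp cross1 with h1 | h1
      · exact abs_eq_zero.mp h1
      · exact absurd (abs_eq_zero.mp h1) hy'ne
    rw [hx, hx'] at hpos
    simp only [zero_mul, zero_add] at hpos
    unfold phase
    rw [hx, hx']
    simp only [lt_self_iff_false, if_false]
    rcases lt_or_gt_of_ne hy'ne with hn | hp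
    · have : ℓ.y < 0 := by nlinarith
      rw [if_neg (not_lt.mpr hn.le), if_neg (not_lt.mpr this.le)]
    · have : 0 < ℓ.y := by nlinarith
      rw [if_pos hp, if_pos this]
  · -- `ℓ'` on the x-axis
    have hx'ne : ℓ'.x ≠ 0 := by
      intro hx'; rw [hx', hy'] at hc; simp at hc
    have hy : ℓ.y = 0 := by
      rcases mul_eq_zero.mp cross2 with h1 | h1
      · exact abs_eq_zero.mp h1
      · exact absurd (abs_eq_zero.mp h1) hx'ne
    rw [hy, hy'] at hpos
    simp only [mul_zero, add_zero] at hpos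
    unfold phase
    rw [hy, hy']
    simp only [lt_self_iff_false, if_false]
    rcases lt_or_gt_of_ne hx'ne with hn | hp
    · have : ℓ.x < 0 := by nlinarith
      rw [if_neg (not_lt.mpr hn.le), if_neg (not_lt.mpr this.le), if_pos hn, if_pos this]
    · have : 0 < ℓ.x := by nlinarith
      rw [if_pos hp, if_pos this]

/-! ## §2 Cells: hub-free cells, phase classes, the charge volume `V` -/

/-- a cell with no hub: every letter charged. -/
abbrev HubFree (c : Cell) : Prop := ∀ f : Fin 4, 0 < (c f).colevel

/-- the phase class of a cell (meaningful on hub-free axis cells). -/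
def cphase (c : Cell) : Fin 4 → ZMod 4 := fun f => phase (c f)

/-- the CHARGE VOLUME `V(c) = ∏_f c_f` (`= dep_h` on the alphabet; `0` iff the cell carries a hub). -/
def V (c : Cell) : ℤ := ∏ f : Fin 4, (c f).colevel

/-- every letter of the cell is an axis letter (`x·y = 0`: the hub or a LINE letter `c·u`, `u ∈ μ₄`). -/
def AxisCell (c : Cell) : Prop := ∀ f : Fin 4, (c f).isAxis

/-- THE AXIS ROOM: every support cell is an axis cell. -/
def AxisRoom (D : Design) : Prop := ∀ c ∈ D.suppN ++ D.suppP, AxisCell c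

/-- THE RELAXED AXIS ROOM: every HUB-FREE support cell is an axis cell (hub-bearing support cells are arbitrary: they are invisible to
the class measure and to every decorated row). -/
def AxisRoomHF (D : Design) : Prop := ∀ c ∈ D.suppN ++ D.suppP, HubFree c → AxisCell c

theorem axisRoomHF_of_axisRoom {D : Design} (hR : AxisRoom D) : AxisRoomHF D := fun c hc _ => hR c hc

theorem V_nonneg (c : Cell) : 0 ≤ V c := Finset.prod_nonneg fun f _ => colevel_nonneg (c f)

theorem V_pos_of_hubFree {c : Cell} (hc : HubFree c) : 0 < V c := Finset.prod_pos fun f _ => hc f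

theorem V_eq_zero_of_not_hubFree {c : Cell} (hc : ¬ HubFree c) : V c = 0 := by
  obtain ⟨f, hf⟩ := not_forall.mp hc
  have h0 : (c f).colevel = 0 := le_antisymm (not_lt.mp hf) (colevel_nonneg _)
  exact Finset.prod_eq_zero (Finset.mem_univ f) h0

/-- **cell-level slide**: a weak arrow `x → y` between axis cells on the alphabet with `y` hub-free keeps the phase class and every
co-level can only grow downward; in particular `x` is hub-free and `V y ≤ V x`. -/
theorem slide_cell {h : ℤ} {x y : Cell} (hx : ∀ f, (x f).OnAlphabet h) (hy : ∀ f, (y f).OnAlphabet h)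
    (hax : AxisCell x) (hay : AxisCell y) (hyf : HubFree y) (hw : WeakLive x y) :
    cphase x = cphase y ∧ (∀ f, (y f).colevel ≤ (x f).colevel) := by
  have key := fun f => slide (hx f) (hy f) (hax f) (hay f) (hyf f) (hw f)
  exact ⟨funext fun f => (key f).1, fun f => (key f).2⟩

theorem hubFree_of_slide {x y : Cell} (hyf : HubFree y) (hle : ∀ f, (y f).colevel ≤ (x f).colevel) : HubFree x :=
  fun f => lt_of_lt_of_le (hyf f) (hle f)

theorem V_le_of_slide {x y : Cell} (hle : ∀ f, (y f).colevel ≤ (x f).colevel) : V y ≤ V x :=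
  Finset.prod_le_prod (fun f _ => colevel_nonneg (y f)) fun f _ => hle f

/-- on the alphabet a non-dead step never increases the co-level (no axis hypothesis). -/
theorem colevel_le_of_notDead {h : ℤ} {ℓ ℓ' : Letter} (hℓ : ℓ.OnAlphabet h) (hℓ' : ℓ'.OnAlphabet h) (hnd : NotDead ℓ ℓ') :
    ℓ'.colevel ≤ ℓ.colevel := by
  rcases hnd with e | ⟨ha, -⟩
  · subst e; exact le_rfl
  have e1 := colevel_eq_of_onAlphabet hℓ
  have e2 := colevel_eq_of_onAlphabet hℓ'
  omega

/-- in ANY room on the alphabet, a weak arrow into a hub-free cell comes from a hub-free cell. -/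
theorem hubFree_of_weakLive {h : ℤ} {x y : Cell} (hx : ∀ f, (x f).OnAlphabet h) (hy : ∀ f, (y f).OnAlphabet h)
    (hyf : HubFree y) (hw : WeakLive x y) : HubFree x :=
  hubFree_of_slide hyf fun f => colevel_le_of_notDead (hx f) (hy f) (hw f)

/-! ## §3 Class down-sets and the ORDER-IDEAL COUNT: positive classes cost rank -/

/-- the threshold down-set of ONE class: hub-free cells of phase class `τ` with charge volume `≥ s`. -/
abbrev InCl (τ : Fin 4 → ZMod 4) (s : ℤ) (c : Cell) : Prop := HubFree c ∧ cphase c = τ ∧ s ≤ V c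

/-- the union over a family of classes with thresholds `t`. -/
abbrev InClass (A : Finset (Fin 4 → ZMod 4)) (t : (Fin 4 → ZMod 4) → ℤ) (c : Cell) : Prop :=
  HubFree c ∧ cphase c ∈ A ∧ t (cphase c) ≤ V c

theorem onAlphabet_of_memP {h : ℤ} {D : Design} (hD : D.OnAlphabet h) {x : Cell} (hx : x ∈ D.suppP) : ∀ f, (x f).OnAlphabet h :=
  hD x (List.mem_append_right _ hx)

theorem onAlphabet_of_memN {h : ℤ} {D : Design} (hD : D.OnAlphabet h) {y : Cell} (hy : y ∈ D.suppN) : ∀ f, (y f).OnAlphabet h :=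
  hD y (List.mem_append_left _ hy)

/-- in the axis room every class union is down-closed relative to the supports. -/
theorem downClosedOn_inClass {h : ℤ} {D : Design} (hD : D.OnAlphabet h) (hR : AxisRoomHF D)
    (A : Finset (Fin 4 → ZMod 4)) (t : (Fin 4 → ZMod 4) → ℤ) : DownClosedOn D (InClass A t) := by
  intro x hx y hy hw hyL
  obtain ⟨hyf, hyA, hyt⟩ := hyL
  have hxf := hubFree_of_weakLive (onAlphabet_of_memP hD hx) (onAlphabet_of_memN hD hy) hyf hw
  obtain ⟨hph, hle⟩ := slide_cell (onAlphabet_of_memP hD hx) (onAlphabet_of_memN hD hy)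
    (hR x (List.mem_append_right _ hx) hxf) (hR y (List.mem_append_left _ hy) hyf) hyf hw
  refine ⟨hxf, ?_, ?_⟩
  · rw [hph]; exact hyA
  · rw [hph]; exact le_trans hyt (V_le_of_slide hle)

theorem massOn_cons (a : Cell × ℕ) (l : List (Cell × ℕ)) (U : Cell → Prop) [DecidablePred U] :
    massOn (a :: l) U = (if U a.1 then a.2 else 0) + massOn l U := by
  unfold massOn
  rw [List.filter_cons]
  by_cases h : U a.1
  · simp [h]
  · simp [h]

/-- the mass of a class union is the sum of the class masses. -/
theorem massOn_inClass_eq_sum (L : List (Cell × ℕ)) (A : Finset (Fin 4 → ZMod 4)) (t : (Fin 4 → ZMod 4) → ℤ) :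
    massOn L (InClass A t) = ∑ τ ∈ A, massOn L (InCl τ (t τ)) := by
  induction L with
  | nil => simp [massOn]
  | cons a l ih =>
    rw [massOn_cons, ih, Finset.sum_congr rfl fun τ _ => massOn_cons a l (InCl τ (t τ)), Finset.sum_add_distrib]
    congr 1
    by_cases hf : HubFree a.1
    · by_cases hA : cphase a.1 ∈ A
      · rw [← Finset.add_sum_erase A _ hA]
        have hrest : ∑ τ ∈ A.erase (cphase a.1), (if InCl τ (t τ) a.1 then a.2 else 0) = 0 := by
          refine Finset.sum_eq_zero fun τ hτ => ?_
          rw [if_neg]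
          rintro ⟨-, hph, -⟩
          exact (Finset.ne_of_mem_erase hτ) hph.symm
        rw [hrest, add_zero]
        by_cases ht : t (cphase a.1) ≤ V a.1
        · rw [if_pos ⟨hf, hA, ht⟩, if_pos ⟨hf, rfl, ht⟩]
        · rw [if_neg (fun h => ht h.2.2), if_neg (fun h => ht h.2.2)]
      · rw [if_neg (fun h => hA h.2.1)]
        symm
        refine Finset.sum_eq_zero fun τ hτ => ?_
        rw [if_neg]
        rintro ⟨-, hph, -⟩
        exact hA (hph ▸ hτ)
    · rw [if_neg (fun h => hf h.1)]
      symm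
      exact Finset.sum_eq_zero fun τ _ => by rw [if_neg (fun h => hf h.1)]

/-- the class EXCESS at threshold `s`: `n(N_τ ∩ {V ≥ s}) − m(P_τ ∩ {V ≥ s})`. -/
def exc (D : Design) (τ : Fin 4 → ZMod 4) (s : ℤ) : ℤ := (massOn D.N (InCl τ s) : ℤ) - massOn D.P (InCl τ s)

/-- **THE ORDER-IDEAL COUNT (HallUp)**: in the axis room, for every family of classes with thresholds of positive excess, the number of
classes is at most `Σ excess ≤ rank`. -/
theorem card_le_rank_of_exc_pos {h : ℤ} {D : Design} (hD : D.OnAlphabet h) (hR : AxisRoomHF D) (hH : HallUp D)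
    (A : Finset (Fin 4 → ZMod 4)) (t : (Fin 4 → ZMod 4) → ℤ) (hpos : ∀ τ ∈ A, 1 ≤ exc D τ (t τ)) :
    (A.card : ℤ) ≤ D.rank := by
  have hcut := hallUp_down_cut D hH (InClass A t) (downClosedOn_inClass hD hR A t)
  rw [massOn_inClass_eq_sum, massOn_inClass_eq_sum, Nat.cast_sum, Nat.cast_sum, ← Finset.sum_sub_distrib] at hcut
  calc (A.card : ℤ) = ∑ τ ∈ A, (1 : ℤ) := by simp
    _ ≤ ∑ τ ∈ A, ((massOn D.N (InCl τ (t τ)) : ℤ) - massOn D.P (InCl τ (t τ))) := Finset.sum_le_sum fun τ hτ => hpos τ hτ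
    _ ≤ D.rank := hcut

/-- **THE ORDER-IDEAL COUNT WITH SURPLUS (HallPlusUp 8)**: as soon as some positive P-mass lies outside the class union, the count
improves by the surplus: `#A + 8 ≤ rank`. -/
theorem card_add_eight_le_rank_of_exc_pos {h : ℤ} {D : Design} (hD : D.OnAlphabet h) (hR : AxisRoomHF D) (hH8 : HallPlusUp D 8)
    (A : Finset (Fin 4 → ZMod 4)) (t : (Fin 4 → ZMod 4) → ℤ) (hpos : ∀ τ ∈ A, 1 ≤ exc D τ (t τ))
    (hout : 0 < massOn D.P fun c => ¬ InClass A t c) :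
    (A.card : ℤ) + 8 ≤ D.rank := by
  have hcut := hallPlusUp_down_cut D 8 hH8 (InClass A t) (downClosedOn_inClass hD hR A t) hout
  rw [massOn_inClass_eq_sum, massOn_inClass_eq_sum, Nat.cast_sum, Nat.cast_sum, ← Finset.sum_sub_distrib] at hcut
  have : (A.card : ℤ) ≤ ∑ τ ∈ A, ((massOn D.N (InCl τ (t τ)) : ℤ) - massOn D.P (InCl τ (t τ))) := by
    calc (A.card : ℤ) = ∑ τ ∈ A, (1 : ℤ) := by simp
      _ ≤ _ := Finset.sum_le_sum fun τ hτ => hpos τ hτ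
  push_cast at hcut
  linarith

/-! ## §4 The class measure `ω` and its layer-cake decomposition into threshold excesses -/

/-- the `V`-weight of class `τ`: `V(c)` on hub-free cells of phase class `τ`, `0` elsewhere. -/
def wcl (τ : Fin 4 → ZMod 4) (c : Cell) : ℤ := if HubFree c ∧ cphase c = τ then V c else 0

/-- **THE CLASS MEASURE** `ω(τ) = Σ_{N hub-free, class τ} n·V − Σ_{P hub-free, class τ} m·V` on the phase torus `(ℤ/4)⁴`. -/
def omegaC (D : Design) (τ : Fin 4 → ZMod 4) : ℤ := linZ D.N (wcl τ) - linZ D.P (wcl τ)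

theorem wcl_nonneg (τ : Fin 4 → ZMod 4) (c : Cell) : 0 ≤ wcl τ c := by
  unfold wcl; split_ifs
  · exact V_nonneg c
  · exact le_rfl

theorem linZ_indicator (L : List (Cell × ℕ)) (U : Cell → Prop) [DecidablePred U] :
    linZ L (fun c => if U c then 1 else 0) = (massOn L U : ℤ) := by
  induction L with
  | nil => simp [linZ, massOn]
  | cons a l ih =>
    rw [linZ_cons, massOn_cons, ih]
    push_cast
    split_ifs <;> simp

theorem linZ_finset_sum {ι : Type*} (L : List (Cell × ℕ)) (S : Finset ι) (g : ι → Cell → ℤ) :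
    linZ L (fun c => ∑ i ∈ S, g i c) = ∑ i ∈ S, linZ L (g i) := by
  induction L with
  | nil => simp [linZ]
  | cons a l ih =>
    rw [linZ_cons, ih, Finset.mul_sum, ← Finset.sum_add_distrib]
    exact Finset.sum_congr rfl fun i _ => by rw [linZ_cons]

/-- a crude common bound for the charge volumes of the entries: `T = Σ_N n·V + Σ_P m·V`. -/
def Tbig (D : Design) : ℤ := linZ D.N V + linZ D.P V

theorem single_le_linZ (L : List (Cell × ℕ)) {cm : Cell × ℕ} (hcm : cm ∈ L) (hpos : 0 < cm.2) : V cm.1 ≤ linZ L V := by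
  unfold linZ
  have hmem : (cm.2 : ℤ) * V cm.1 ∈ L.map fun cm => (cm.2 : ℤ) * V cm.1 := List.mem_map.mpr ⟨cm, hcm, rfl⟩
  have hle := List.single_le_sum (fun x hx => by
    obtain ⟨d, -, rfl⟩ := List.mem_map.mp hx
    exact mul_nonneg (by exact_mod_cast Nat.zero_le _) (V_nonneg _)) _ hmem
  have h1 : (1 : ℤ) ≤ cm.2 := by exact_mod_cast hpos
  nlinarith [V_nonneg cm.1]

theorem V_le_Tbig_N (D : Design) {cm : Cell × ℕ} (hcm : cm ∈ D.N) (hpos : 0 < cm.2) : V cm.1 ≤ Tbig D := by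
  have h1 := single_le_linZ D.N hcm hpos
  have h2 : 0 ≤ linZ D.P V := linZ_nonneg _ _ fun cm _ _ => V_nonneg _
  unfold Tbig; linarith

theorem V_le_Tbig_P (D : Design) {cm : Cell × ℕ} (hcm : cm ∈ D.P) (hpos : 0 < cm.2) : V cm.1 ≤ Tbig D := by
  have h1 := single_le_linZ D.P hcm hpos
  have h2 : 0 ≤ linZ D.N V := linZ_nonneg _ _ fun cm _ _ => V_nonneg _
  unfold Tbig; linarith

/-- layer cake: `V·[class τ] = Σ_{s=1}^{T} [class τ ∧ s ≤ V]` for `V ≤ T`. -/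
theorem wcl_eq_sum_indicator (τ : Fin 4 → ZMod 4) (c : Cell) {T : ℤ} (hT : V c ≤ T) :
    wcl τ c = ∑ s ∈ Finset.Icc 1 T, (if InCl τ s c then (1 : ℤ) else 0) := by
  by_cases hf : HubFree c ∧ cphase c = τ
  · have step : ∀ s ∈ Finset.Icc 1 T, (if InCl τ s c then (1 : ℤ) else 0) = if s ≤ V c then 1 else 0 := by
      intro s _
      by_cases hs : s ≤ V c
      · rw [if_pos ⟨hf.1, hf.2, hs⟩, if_pos hs]
      · rw [if_neg (fun h => hs h.2.2), if_neg hs]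
    rw [Finset.sum_congr rfl step, Finset.sum_ite, Finset.sum_const_zero, add_zero, Finset.sum_const, nsmul_eq_mul, mul_one]
    have hfil : (Finset.Icc 1 T).filter (fun s => s ≤ V c) = Finset.Icc 1 (V c) := by
      ext s; simp only [Finset.mem_filter, Finset.mem_Icc]; omega
    rw [hfil, Int.card_Icc]
    unfold wcl; rw [if_pos hf]
    have := V_nonneg c
    omega
  · unfold wcl; rw [if_neg hf]
    symm
    exact Finset.sum_eq_zero fun s _ => by rw [if_neg (fun h => hf ⟨h.1, h.2.1⟩)]

/-- **layer cake for the class measure**: `ω(τ) = Σ_{s=1}^{T} exc(τ, s)`. -/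
theorem omegaC_eq_sum_exc (D : Design) (τ : Fin 4 → ZMod 4) :
    omegaC D τ = ∑ s ∈ Finset.Icc 1 (Tbig D), exc D τ s := by
  unfold omegaC exc
  rw [linZ_congr' D.N (wcl τ) (fun c => ∑ s ∈ Finset.Icc 1 (Tbig D), (if InCl τ s c then (1 : ℤ) else 0))
      (fun cm hcm hpos => wcl_eq_sum_indicator τ cm.1 (V_le_Tbig_N D hcm hpos)),
    linZ_congr' D.P (wcl τ) (fun c => ∑ s ∈ Finset.Icc 1 (Tbig D), (if InCl τ s c then (1 : ℤ) else 0))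
      (fun cm hcm hpos => wcl_eq_sum_indicator τ cm.1 (V_le_Tbig_P D hcm hpos)),
    linZ_finset_sum, linZ_finset_sum, ← Finset.sum_sub_distrib]
  exact Finset.sum_congr rfl fun s _ => by rw [linZ_indicator, linZ_indicator]

/-- a positive class has a threshold of positive excess. -/
theorem exists_exc_pos {D : Design} {τ : Fin 4 → ZMod 4} (hω : 0 < omegaC D τ) : ∃ s, 1 ≤ exc D τ s := by
  rw [omegaC_eq_sum_exc] at hω
  have h0 : ∑ s ∈ Finset.Icc 1 (Tbig D), (0 : ℤ) < ∑ s ∈ Finset.Icc 1 (Tbig D), exc D τ s := by simpa using hω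
  obtain ⟨s, -, hs⟩ := Finset.exists_lt_of_sum_lt h0
  exact ⟨s, hs⟩

/-- **POSITIVE CLASSES COST RANK**: `#{τ : ω(τ) > 0} ≤ rank` from `HallUp` … -/
theorem posClasses_card_le_rank {h : ℤ} {D : Design} (hD : D.OnAlphabet h) (hR : AxisRoomHF D) (hH : HallUp D)
    (A : Finset (Fin 4 → ZMod 4)) (hA : ∀ τ ∈ A, 0 < omegaC D τ) : (A.card : ℤ) ≤ D.rank := by
  classical
  have ht : ∀ τ, ∃ s : ℤ, τ ∈ A → 1 ≤ exc D τ s := fun τ =>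
    if hτ : τ ∈ A then (exists_exc_pos (hA τ hτ)).imp fun s hs _ => hs else ⟨0, fun h => absurd h hτ⟩
  choose t ht using ht
  exact card_le_rank_of_exc_pos hD hR hH A t fun τ hτ => ht τ hτ

theorem massOn_pos_of_mem_suppP {D : Design} {x : Cell} (hx : x ∈ D.suppP) (U : Cell → Prop) [DecidablePred U] (hU : U x) :
    0 < massOn D.P U := by
  obtain ⟨m, hm, hpos⟩ := (mem_suppP_iff D x).mp hx
  have hmem : m ∈ (D.P.filter fun cm => decide (U cm.1)).map Prod.snd :=
    List.mem_map.mpr ⟨(x, m), List.mem_filter.mpr ⟨hm, by simpa using hU⟩, rfl⟩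
  exact lt_of_lt_of_le hpos (List.le_sum_of_mem hmem)

/-- … and `#{τ : ω(τ) > 0} + 8 ≤ rank` from `HallPlusUp 8` as soon as a supported P-cell carries a HUB (it lies outside every class
union; more generally: as soon as some positive P-mass lies outside the union, `card_add_eight_le_rank_of_exc_pos`). -/
theorem posClasses_card_add_eight_le_rank {h : ℤ} {D : Design} (hD : D.OnAlphabet h) (hR : AxisRoomHF D) (hH8 : HallPlusUp D 8)
    (A : Finset (Fin 4 → ZMod 4)) (hA : ∀ τ ∈ A, 0 < omegaC D τ) (hhub : ∃ x ∈ D.suppP, ¬ HubFree x) :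
    (A.card : ℤ) + 8 ≤ D.rank := by
  classical
  have ht : ∀ τ, ∃ s : ℤ, τ ∈ A → 1 ≤ exc D τ s := fun τ =>
    if hτ : τ ∈ A then (exists_exc_pos (hA τ hτ)).imp fun s hs _ => hs else ⟨0, fun h => absurd h hτ⟩
  choose t ht using ht
  obtain ⟨x, hx, hxh⟩ := hhub
  exact card_add_eight_le_rank_of_exc_pos hD hR hH8 A t (fun τ hτ => ht τ hτ)
    (massOn_pos_of_mem_suppP hx _ (fun hin => hxh hin.1))

/-! ## §5 The total mass of `ω` is the depth functional `E`, which VANISHES in the axis room -/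

theorem sum_wcl_eq (c : Cell) : ∑ τ : Fin 4 → ZMod 4, wcl τ c = V c := by
  by_cases hf : HubFree c
  · have : ∀ τ : Fin 4 → ZMod 4, wcl τ c = if cphase c = τ then V c else 0 := fun τ => by
      unfold wcl; by_cases hτ : cphase c = τ <;> simp [hf, hτ]
    rw [Finset.sum_congr rfl fun τ _ => this τ, Finset.sum_ite_eq]; simp
  · rw [V_eq_zero_of_not_hubFree hf]
    exact Finset.sum_eq_zero fun τ _ => by unfold wcl; rw [if_neg (fun h => hf h.1)]

theorem V_eq_dep {h : ℤ} {c : Cell} (hc : ∀ f, (c f).OnAlphabet h) : V c = dep h c := by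
  unfold V dep
  exact Finset.prod_congr rfl fun f _ => colevel_eq_of_onAlphabet (hc f)

/-- `Σ_τ ω(τ) = E_h(D)` on the alphabet. -/
theorem sum_omegaC_eq_E {h : ℤ} {D : Design} (hD : D.OnAlphabet h) : ∑ τ : Fin 4 → ZMod 4, omegaC D τ = E h D := by
  unfold omegaC
  rw [Finset.sum_sub_distrib, ← linZ_finset_sum, ← linZ_finset_sum,
    linZ_congr' D.N (fun c => ∑ τ : Fin 4 → ZMod 4, wcl τ c) (dep h) (fun cm hcm hpos => by
      show (∑ τ : Fin 4 → ZMod 4, wcl τ cm.1) = dep h cm.1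
      rw [sum_wcl_eq]; exact V_eq_dep (onAlphabet_of_memN hD ((mem_suppN_iff D cm.1).mpr ⟨cm.2, hcm, hpos⟩))),
    linZ_congr' D.P (fun c => ∑ τ : Fin 4 → ZMod 4, wcl τ c) (dep h) (fun cm hcm hpos => by
      show (∑ τ : Fin 4 → ZMod 4, wcl τ cm.1) = dep h cm.1
      rw [sum_wcl_eq]; exact V_eq_dep (onAlphabet_of_memP hD ((mem_suppP_iff D cm.1).mpr ⟨cm.2, hcm, hpos⟩)))]
  rfl

theorem pw_eq_zero_of_axisCell {c : Cell} (hc : AxisCell c) (g g' : Fin 4) : pw g g' c = 0 := by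
  unfold pw; rw [abs_mul_abs_eq_zero_of_isAxis (hc g), zero_mul]

/-- **`E = 0` IN THE AXIS ROOM** (pair law: `E = 4·(pair-weight mass)`, and axis letters have pair weight `0`). -/
theorem E_eq_zero_of_axisRoom {h : ℤ} {D : Design} (hD : D.OnAlphabet h) (h1 : D.A1) (hR : AxisRoom D) : E h D = 0 := by
  rw [pair_law_alphabet hD h1 (show (0 : Fin 4) ≠ 1 by decide),
    linZ_eq_zero_of_vanish D.N _ (fun cm hcm hpos =>
      pw_eq_zero_of_axisCell (hR cm.1 (List.mem_append_left _ ((mem_suppN_iff D cm.1).mpr ⟨cm.2, hcm, hpos⟩))) 0 1),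
    linZ_eq_zero_of_vanish D.P _ (fun cm hcm hpos =>
      pw_eq_zero_of_axisCell (hR cm.1 (List.mem_append_right _ ((mem_suppP_iff D cm.1).mpr ⟨cm.2, hcm, hpos⟩))) 0 1)]
  simp

/-! ## §6 The bridge to the finite PHASE-TORUS LAW: the clean moments of `ω` are decorated e-rows -/

/-- the class measure as a real function on the phase torus. -/
noncomputable def omegaR (D : Design) : PT → ℝ := fun τ => (omegaC D τ : ℝ)

/-- the decoration pattern read by the character `k` (`0 ↦ c = h − a`, `1 ↦ β`, `3 ↦ β̄`; `2` never used). -/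
def pat (k : PT) : Fin 4 → DS := fun f => if k f = 0 then DS.C else if k f = 1 then DS.Eb else DS.E

/-- the cell functional of pattern `pat k`. -/
def Phi (h : ℤ) (k : PT) (c : Cell) : GaussianInt := ∏ f : Fin 4, dval h (pat k f) (c f)

/-- `β = c·i^{phase}` for a charged axis letter. -/
theorem toComplex_beta {ℓ : Letter} (hax : ℓ.isAxis) (hc : 0 < ℓ.colevel) :
    ((ℓ.beta : GaussianInt) : ℂ) = (ℓ.colevel : ℂ) * e (phase ℓ) := by
  unfold Letter.isAxis at hax
  unfold Letter.colevel at hc ⊢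
  unfold phase e Letter.beta
  rcases lt_trichotomy 0 ℓ.x with hx | hx | hx
  · have hy : ℓ.y = 0 := by
      rcases mul_eq_zero.mp hax with h | h
      · exact absurd h hx.ne'
      · exact h
    rw [if_pos hx, hy, abs_zero, add_zero, abs_of_pos hx]
    simp [GaussianInt.toComplex_def₂, Complex.ext_iff]
  · rw [← hx] at hc ⊢
    simp only [abs_zero, zero_add] at hc ⊢
    rw [if_neg (lt_irrefl 0)]
    rcases lt_or_gt_of_ne (show ℓ.y ≠ 0 from fun h => by rw [h] at hc; simp at hc) with hy | hy
    · rw [if_neg (not_lt.mpr hy.le), if_neg (lt_irrefl 0), abs_of_neg hy]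
      have : ((3 : ZMod 4)).val = 3 := rfl
      rw [this]
      simp [GaussianInt.toComplex_def₂, Complex.ext_iff, pow_succ, Complex.I_mul_I]
    · rw [if_pos hy, abs_of_pos hy]
      have : ((1 : ZMod 4)).val = 1 := rfl
      rw [this]
      simp [GaussianInt.toComplex_def₂, Complex.ext_iff]
  · have hy : ℓ.y = 0 := by
      rcases mul_eq_zero.mp hax with h | h
      · exact absurd h hx.ne
      · exact h
    rw [if_neg (not_lt.mpr hx.le), hy, if_neg (lt_irrefl 0), if_pos hx, abs_zero, add_zero, abs_of_neg hx]
    have : ((2 : ZMod 4)).val = 2 := rfl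
    rw [this]
    simp [GaussianInt.toComplex_def₂, Complex.ext_iff, pow_succ, Complex.I_mul_I]

/-- `β̄ = c·i^{3·phase}`. -/
theorem toComplex_star_beta {ℓ : Letter} (hax : ℓ.isAxis) (hc : 0 < ℓ.colevel) :
    ((star ℓ.beta : GaussianInt) : ℂ) = (ℓ.colevel : ℂ) * e (3 * phase ℓ) := by
  rw [GaussianInt.toComplex_star, toComplex_beta hax hc, map_mul, e_three_mul]
  simp

/-- the per-slot dictionary: `c_f · i^{k_f·phase} = dval (pat k f)` for a charged axis letter on the alphabet (`k_f ≠ 2`). -/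
theorem slot_bridge {h : ℤ} {ℓ : Letter} (hℓ : ℓ.OnAlphabet h) (hax : ℓ.isAxis) (hc : 0 < ℓ.colevel) (k : PT) (f : Fin 4)
    (hk : k f ≠ 2) : (ℓ.colevel : ℂ) * e (k f * phase ℓ) = ((dval h (pat k f) ℓ : GaussianInt) : ℂ) := by
  unfold pat
  rcases zmod4_cases (k f) with h0 | h1 | h2 | h3
  · rw [if_pos h0, h0, zero_mul]
    show (ℓ.colevel : ℂ) * e 0 = ((((h - ℓ.a : ℤ)) : GaussianInt) : ℂ)
    unfold e
    rw [ZMod.val_zero, pow_zero, mul_one, map_intCast, ← colevel_eq_of_onAlphabet hℓ]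
  · rw [if_neg (by rw [h1]; decide), if_pos h1, h1, one_mul]
    show (ℓ.colevel : ℂ) * e (phase ℓ) = ((ℓ.beta : GaussianInt) : ℂ)
    rw [toComplex_beta hax hc]
  · exact absurd h2 hk
  · rw [if_neg (by rw [h3]; decide), if_neg (by rw [h3]; decide), h3]
    show (ℓ.colevel : ℂ) * e (3 * phase ℓ) = ((star ℓ.beta : GaussianInt) : ℂ)
    rw [toComplex_star_beta hax hc]

/-- the cell dictionary: `V(c)·χ_k(phase c) = Φ_k(c)` on hub-free axis cells of the alphabet … -/
theorem cell_bridge {h : ℤ} {c : Cell} (hc : ∀ f, (c f).OnAlphabet h) (hax : AxisCell c) (hf : HubFree c) (k : PT)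
    (hk : ∀ f, k f ≠ 2) : (V c : ℂ) * chi k (cphase c) = ((Phi h k c : GaussianInt) : ℂ) := by
  unfold V Phi
  rw [chi_eq_prod_e, Int.cast_prod, ← Finset.prod_mul_distrib, map_prod]
  exact Finset.prod_congr rfl fun f _ => slot_bridge (hc f) (hax f) (hf f) k f (hk f)

/-- … and `Φ_k(c) = 0` on a cell with a hub. -/
theorem Phi_eq_zero_of_not_hubFree {h : ℤ} {c : Cell} (hc : ∀ f, (c f).OnAlphabet h) (hf : ¬ HubFree c) (k : PT) :
    Phi h k c = 0 := by
  obtain ⟨f, hf⟩ := not_forall.mp hf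
  have h0 : (c f).colevel = 0 := le_antisymm (not_lt.mp hf) (colevel_nonneg _)
  obtain ⟨hx, hy⟩ := (colevel_eq_zero_iff _).mp h0
  have hb : (c f).beta = 0 := by
    rw [Letter.beta, hx, hy]; rfl
  unfold Phi
  apply Finset.prod_eq_zero (Finset.mem_univ f)
  unfold pat
  split_ifs
  · show (((h - (c f).a : ℤ)) : GaussianInt) = 0
    rw [← colevel_eq_of_onAlphabet (hc f), h0]; rfl
  · show (c f).beta = 0
    exact hb
  · show star (c f).beta = 0
    rw [hb, star_zero]

theorem sum_linZ_wcl_chi (L : List (Cell × ℕ)) (k : PT) :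
    (∑ τ : PT, ((linZ L (wcl τ) : ℤ) : ℂ) * chi k τ)
      = (L.map fun cm => (cm.2 : ℂ) * (if HubFree cm.1 then (V cm.1 : ℂ) * chi k (cphase cm.1) else 0)).sum := by
  induction L with
  | nil => simp [linZ]
  | cons a l ih =>
    simp only [linZ_cons, Int.cast_add, Int.cast_mul, Int.cast_natCast, add_mul, Finset.sum_add_distrib, List.map_cons,
      List.sum_cons]
    rw [ih]
    congr 1
    by_cases hf : HubFree a.1
    · have : ∀ τ : PT, ((a.2 : ℂ) * ((wcl τ a.1 : ℤ) : ℂ)) * chi k τ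
          = if cphase a.1 = τ then (a.2 : ℂ) * ((V a.1 : ℂ) * chi k τ) else 0 := fun τ => by
        unfold wcl
        by_cases hτ : cphase a.1 = τ
        · rw [if_pos ⟨hf, hτ⟩, if_pos hτ]; ring
        · rw [if_neg (fun h => hτ h.2), if_neg hτ]; simp
      rw [Finset.sum_congr rfl fun τ _ => this τ, Finset.sum_ite_eq, if_pos (Finset.mem_univ _), if_pos hf]
    · rw [if_neg hf, mul_zero]
      exact Finset.sum_eq_zero fun τ _ => by unfold wcl; rw [if_neg (fun h => hf h.1)]; simp

theorem toComplex_wsum (L : List (Cell × ℕ)) (φ : Cell → GaussianInt) :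
    ((wsum L φ : GaussianInt) : ℂ) = (L.map fun cm => (cm.2 : ℂ) * ((φ cm.1 : GaussianInt) : ℂ)).sum := by
  induction L with
  | nil => simp [wsum_nil]
  | cons a l ih => rw [wsum_cons, map_add, map_mul, map_natCast, ih, List.map_cons, List.sum_cons]

/-- **THE MOMENT DICTIONARY**: in the axis room, for every frequency `k` without a `2`,
`ω̂(k) = Σ_τ ω(τ) χ_k(τ) = (Σ_N − Σ_P) m·Φ_k` — a decorated e-row of `ShellThreePairLaw` §9. -/
theorem moment_omegaR {h : ℤ} {D : Design} (hD : D.OnAlphabet h) (hR : AxisRoomHF D) (k : PT) (hk : ∀ f, k f ≠ 2) :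
    moment (omegaR D) k = ((wsum D.N (Phi h k) - wsum D.P (Phi h k) : GaussianInt) : ℂ) := by
  have side : ∀ (L : List (Cell × ℕ)), (∀ cm ∈ L, 0 < cm.2 → (∀ f, (cm.1 f).OnAlphabet h) ∧ (HubFree cm.1 → AxisCell cm.1)) →
      (∑ τ : PT, ((linZ L (wcl τ) : ℤ) : ℂ) * chi k τ) = ((wsum L (Phi h k) : GaussianInt) : ℂ) := by
    intro L hL
    rw [sum_linZ_wcl_chi, toComplex_wsum]
    congr 1
    refine List.map_congr_left fun cm hcm => ?_
    rcases Nat.eq_zero_or_pos cm.2 with h0 | hpos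
    · rw [h0]; simp
    · obtain ⟨hA, hax⟩ := hL cm hcm hpos
      congr 1
      by_cases hf : HubFree cm.1
      · rw [if_pos hf, cell_bridge hA (hax hf) hf k hk]
      · rw [if_neg hf, Phi_eq_zero_of_not_hubFree hA hf, map_zero]
  have hN := side D.N fun cm hcm hpos =>
    have hm : cm.1 ∈ D.suppN := (mem_suppN_iff D cm.1).mpr ⟨cm.2, hcm, hpos⟩
    ⟨onAlphabet_of_memN hD hm, hR cm.1 (List.mem_append_left _ hm)⟩
  have hP := side D.P fun cm hcm hpos =>
    have hm : cm.1 ∈ D.suppP := (mem_suppP_iff D cm.1).mpr ⟨cm.2, hcm, hpos⟩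
    ⟨onAlphabet_of_memP hD hm, hR cm.1 (List.mem_append_right _ hm)⟩
  unfold moment omegaR omegaC
  simp only [Int.cast_sub, Complex.ofReal_sub, Complex.ofReal_intCast, sub_mul, Finset.sum_sub_distrib]
  rw [hN, hP, map_sub]

theorem Phi_zero_eq_dep (h : ℤ) (c : Cell) : Phi h 0 c = ((dep h c : ℤ) : GaussianInt) := by
  unfold Phi dep
  rw [Int.cast_prod]
  refine Finset.prod_congr rfl fun f _ => ?_
  have hp : pat 0 f = DS.C := by unfold pat; rw [if_pos (show (0 : PT) f = 0 from rfl)]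
  rw [hp]; rfl

theorem Phi_one_eq_cellCoef (h : ℤ) (c : Cell) : Phi h (fun _ => 1) c = cellCoef c Word.EEEE := by
  unfold Phi cellCoef Word.EEEE
  refine Finset.prod_congr rfl fun f _ => ?_
  have hp : pat (fun _ => (1 : ZMod 4)) f = DS.Eb := by
    show (if (1 : ZMod 4) = 0 then DS.C else if (1 : ZMod 4) = 1 then DS.Eb else DS.E) = DS.Eb
    rw [if_neg (by decide), if_pos rfl]
  rw [hp]; rfl

/-- the clean moments of `ω` vanish: `k` admissible, `k ≠ 0` by the decorated e-row law (clause 1), `k = 0` by `E = 0`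
(in the axis room: clause 2 + the pair law, `E_eq_zero_of_axisRoom`; in the relaxed room a hypothesis, cf. §9). -/
theorem moment_omegaR_eq_zero {h : ℤ} {D : Design} (hD : D.OnAlphabet h) (hR : AxisRoomHF D) (hE : E h D = 0) (h1 : D.A1)
    (k : PT) (hK : KAdm k) : moment (omegaR D) k = 0 := by
  obtain ⟨hk2, hk1, hk3⟩ := hK
  rw [moment_omegaR hD hR k hk2]
  by_cases hk0 : k = 0
  · subst hk0
    unfold E at hE
    have : wsum D.N (Phi h 0) - wsum D.P (Phi h 0) = (((linZ D.N (dep h) - linZ D.P (dep h) : ℤ)) : GaussianInt) := by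
      rw [funext (Phi_zero_eq_dep h), wsum_cast, wsum_cast]; push_cast; rfl
    rw [this, hE]; simp
  · have hmix : ∃ f, pat k f = DS.E ∨ pat k f = DS.Eb := by
      obtain ⟨f, hf⟩ := Function.ne_iff.mp hk0
      refine ⟨f, ?_⟩
      unfold pat
      rcases zmod4_cases (k f) with h0 | h1' | h2 | h3
      · exact absurd h0 hf
      · right; rw [if_neg (by rw [h1']; decide), if_pos h1']
      · exact absurd h2 (hk2 f)
      · left; rw [if_neg (by rw [h3]; decide), if_neg (by rw [h3]; decide)]
    have hE : ∃ f, pat k f ≠ DS.E := by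
      obtain ⟨f, hf⟩ := Function.ne_iff.mp hk3
      refine ⟨f, ?_⟩
      unfold pat
      rcases zmod4_cases (k f) with h0 | h1' | h2 | h3
      · rw [if_pos h0]; decide
      · rw [if_neg (by rw [h1']; decide), if_pos h1']; decide
      · exact absurd h2 (hk2 f)
      · exact absurd h3 hf
    have hEb : ∃ f, pat k f ≠ DS.Eb := by
      obtain ⟨f, hf⟩ := Function.ne_iff.mp hk1
      refine ⟨f, ?_⟩
      unfold pat
      rcases zmod4_cases (k f) with h0 | h1' | h2 | h3
      · rw [if_pos h0]; decide
      · exact absurd h1' hf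
      · exact absurd h2 (hk2 f)
      · rw [if_neg (by rw [h3]; decide), if_neg (by rw [h3]; decide)]; decide
    have row := decorated_row_law h D (a1e_of_a1 D h1) (pat k) hmix hE hEb
    unfold Phi
    rw [row, sub_self, map_zero]

/-- the top moment of `ω` is `μ̄`. -/
theorem moment_omegaR_top {h : ℤ} {D : Design} (hD : D.OnAlphabet h) (hR : AxisRoomHF D) :
    moment (omegaR D) (fun _ => 1) = ((star D.mu : GaussianInt) : ℂ) := by
  rw [moment_omegaR hD hR (fun _ => 1) (fun _ => by decide), funext (Phi_one_eq_cellCoef h), ← T_eq_wsum, T_EEEE]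

theorem moment_neg_fun (ω : PT → ℝ) (k : PT) : moment (fun τ => -ω τ) k = -moment ω k := by
  unfold moment
  rw [← Finset.sum_neg_distrib]
  exact Finset.sum_congr rfl fun τ _ => by push_cast; ring

/-- **THE PHASE-TORUS STEP**: in the axis room, an (A1)-clean design whose class measure is positive on at most `γ` classes has `μ = 0`
as soon as the phase-torus law holds at corank `γ` (`PhaseTorusLawN γ`; kernel at `γ = 10`: `PhaseTorusBoxLaw.phaseTorusLawN_ten`,
false from `γ = 14` on: `PhaseTorusLawN14.not_phaseTorusLawN_fourteen`). -/
theorem mu_eq_zero_of_few_posClasses {h : ℤ} {D : Design} (hD : D.OnAlphabet h) (hR : AxisRoomHF D) (hE : E h D = 0) (h1 : D.A1)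
    {γ : ℕ} (hlaw : PhaseTorusLawN γ) (A : Finset PT) (hA : A.card ≤ γ) (hneg : ∀ τ, τ ∉ A → omegaC D τ ≤ 0) : D.mu = 0 := by
  have htop := hlaw (omegaR D) A hA (fun τ hτ => by unfold omegaR; exact_mod_cast hneg τ hτ)
    (fun k hK => moment_omegaR_eq_zero hD hR hE h1 k hK)
  rw [moment_omegaR_top hD hR] at htop
  have hs : star D.mu = 0 := GaussianInt.toComplex_injective (by rw [htop, map_zero])
  simpa using congrArg star hs

/-- the mirror step: at most `γ` NEGATIVE classes also forces `μ = 0` (the law applied to `−ω`, whose top moment is `−μ̄`). -/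
theorem mu_eq_zero_of_few_negClasses {h : ℤ} {D : Design} (hD : D.OnAlphabet h) (hR : AxisRoomHF D) (hE : E h D = 0) (h1 : D.A1)
    {γ : ℕ} (hlaw : PhaseTorusLawN γ) (A : Finset PT) (hA : A.card ≤ γ) (hpos : ∀ τ, τ ∉ A → 0 ≤ omegaC D τ) : D.mu = 0 := by
  have htop := hlaw (fun τ => -omegaR D τ) A hA
    (fun τ hτ => by unfold omegaR; have := hpos τ hτ; linarith [show (0 : ℝ) ≤ (omegaC D τ : ℝ) by exact_mod_cast this])
    (fun k hK => by rw [moment_neg_fun, moment_omegaR_eq_zero hD hR hE h1 k hK, neg_zero])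
  rw [moment_neg_fun, moment_omegaR_top hD hR, neg_eq_zero] at htop
  have hs : star D.mu = 0 := GaussianInt.toComplex_injective (by rw [htop, map_zero])
  simpa using congrArg star hs

/-! ## §7 THE AXIS-ROOM PHASE-TORUS LAW (flow-free, every height, budget-free)

Every statement is proved in the RELAXED room `AxisRoomHF` (hub-free support cells axis) from the hypothesis `E_h(D) = 0`, and then
specialised to the axis room `AxisRoom`, where `E = 0` is the pair law (`E_eq_zero_of_axisRoom`); §9 supplies `E = 0` in the relaxed
room from ONE slot pair never doubly off-axis on the support. -/

/-- the positive and the negative classes of the class measure. -/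
noncomputable def posCl (D : Design) : Finset PT := Finset.univ.filter fun τ => 0 < omegaC D τ
noncomputable def negCl (D : Design) : Finset PT := Finset.univ.filter fun τ => omegaC D τ < 0

theorem mem_posCl {D : Design} {τ : PT} : τ ∈ posCl D ↔ 0 < omegaC D τ := by simp [posCl]
theorem mem_negCl {D : Design} {τ : PT} : τ ∈ negCl D ↔ omegaC D τ < 0 := by simp [negCl]

theorem not_mem_posCl {D : Design} : ∀ τ, τ ∉ posCl D → omegaC D τ ≤ 0 :=
  fun _ hτ => not_lt.mp fun hpos => hτ (mem_posCl.mpr hpos)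
theorem not_mem_negCl {D : Design} : ∀ τ, τ ∉ negCl D → 0 ≤ omegaC D τ :=
  fun _ hτ => not_lt.mp fun hneg => hτ (mem_negCl.mpr hneg)

/-- **UP law, rank ≤ 10** (the hub-and-weak-arrow version of `LinePhaseTorus.lineTwoTermUp7_mu_eq_zero`, with the Hall CONDITION of
record in place of flow data, and corank `10` in place of `7`): relaxed axis room + `E = 0` + (A1) + `HallUp` + `rank ≤ 10` ⇒ `μ = 0`. -/
theorem hf_mu_eq_zero_of_rank_le_ten {h : ℤ} {D : Design} (hD : D.OnAlphabet h) (hR : AxisRoomHF D) (hE : E h D = 0) (h1 : D.A1)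
    (hH : HallUp D) (hr : D.rank ≤ 10) : D.mu = 0 := by
  classical
  have hcard := posClasses_card_le_rank hD hR hH (posCl D) fun τ hτ => mem_posCl.mp hτ
  exact mu_eq_zero_of_few_posClasses hD hR hE h1 phaseTorusLawN_ten (posCl D) (by exact_mod_cast hcard.trans hr) not_mem_posCl

theorem axisRoom_mu_eq_zero_of_rank_le_ten {h : ℤ} {D : Design} (hD : D.OnAlphabet h) (hR : AxisRoom D) (h1 : D.A1)
    (hH : HallUp D) (hr : D.rank ≤ 10) : D.mu = 0 :=
  hf_mu_eq_zero_of_rank_le_ten hD (axisRoomHF_of_axisRoom hR) (E_eq_zero_of_axisRoom hD h1 hR) h1 hH hr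

theorem massOn_eq_zero_imp {L : List (Cell × ℕ)} {U : Cell → Prop} [DecidablePred U] (h0 : massOn L U = 0)
    {cm : Cell × ℕ} (hcm : cm ∈ L) (hpos : 0 < cm.2) : ¬ U cm.1 := by
  intro hU
  have hmem : cm.2 ∈ (L.filter fun cm => decide (U cm.1)).map Prod.snd :=
    List.mem_map.mpr ⟨cm, List.mem_filter.mpr ⟨hcm, by simpa using hU⟩, rfl⟩
  have := List.le_sum_of_mem hmem
  unfold massOn at h0
  omega

/-- **the inside case**: if NO positive P-mass lies outside the union of the positive classes' cells above some thresholds, then every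
class outside `{ω > 0}` carries no P-mass, so `ω ≥ 0` everywhere, and `Σ_τ ω(τ) = E = 0` forces `{ω > 0} = ∅`. -/
theorem posCl_eq_empty_of_inside {h : ℤ} {D : Design} (hD : D.OnAlphabet h) (hE : E h D = 0) (t : PT → ℤ)
    (h0 : massOn D.P (fun c => ¬ InClass (posCl D) t c) = 0) : posCl D = ∅ := by
  classical
  have hA : ∀ τ ∈ posCl D, 0 < omegaC D τ := fun τ hτ => mem_posCl.mp hτ
  have hPin : ∀ cm ∈ D.P, 0 < cm.2 → cphase cm.1 ∈ posCl D := fun cm hcm hpos => by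
    have := massOn_eq_zero_imp h0 hcm hpos
    push Not at this
    exact this.2.1
  have hsum := sum_omegaC_eq_E hD
  rw [hE] at hsum
  have hzero : ∀ τ, τ ∉ posCl D → omegaC D τ = 0 := by
    intro τ hτ
    refine le_antisymm (not_mem_posCl τ hτ) ?_
    unfold omegaC
    rw [linZ_eq_zero_of_vanish D.P (wcl τ) (fun cm hcm hpos => by
      unfold wcl; rw [if_neg]; rintro ⟨-, hph⟩; exact hτ (hph ▸ hPin cm hcm hpos)), sub_zero]
    exact linZ_nonneg _ _ fun cm _ _ => wcl_nonneg τ cm.1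
  have hsplit : ∑ τ : PT, omegaC D τ = ∑ τ ∈ posCl D, omegaC D τ := by
    rw [← Finset.sum_subset (Finset.subset_univ (posCl D)) (fun τ _ hτ => hzero τ hτ)]
  have hge : ((posCl D).card : ℤ) ≤ ∑ τ ∈ posCl D, omegaC D τ := by
    calc ((posCl D).card : ℤ) = ∑ τ ∈ posCl D, (1 : ℤ) := by simp
      _ ≤ ∑ τ ∈ posCl D, omegaC D τ := Finset.sum_le_sum fun τ hτ => hA τ hτ
  rw [hsplit] at hsum
  have hc0 : (posCl D).card = 0 := by
    have : ((posCl D).card : ℤ) ≤ 0 := by linarith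
    exact_mod_cast Nat.eq_zero_of_le_zero (by exact_mod_cast this)
  exact Finset.card_eq_zero.mp hc0

/-- **EFFECTIVE DESIGNS ARE `μ`-TRIVIAL** (relaxed room): an (A1)-clean design with NO P-mass and `E = 0` has `μ = 0` — at every rank and
every height, with no Hall condition (`E = Σ_N n·V = 0` forces every supported cell to carry a hub). -/
theorem hf_mu_eq_zero_of_effective {h : ℤ} {D : Design} (hD : D.OnAlphabet h) (hR : AxisRoomHF D) (hE : E h D = 0) (h1 : D.A1)
    (hP : ∀ cm ∈ D.P, cm.2 = 0) : D.mu = 0 := by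
  classical
  have h0 : massOn D.P (fun c => ¬ InClass (posCl D) (fun _ => 0) c) = 0 := by
    unfold massOn
    exact List.sum_eq_zero fun m hm => by
      obtain ⟨cm, hcm, rfl⟩ := List.mem_map.mp hm
      exact hP cm (List.mem_filter.mp hcm).1
  have he := posCl_eq_empty_of_inside hD hE (fun _ => 0) h0
  exact mu_eq_zero_of_few_posClasses hD hR hE h1 phaseTorusLawN_ten (posCl D) (by rw [he]; simp) not_mem_posCl

theorem axisRoom_mu_eq_zero_of_effective {h : ℤ} {D : Design} (hD : D.OnAlphabet h) (hR : AxisRoom D) (h1 : D.A1)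
    (hP : ∀ cm ∈ D.P, cm.2 = 0) : D.mu = 0 :=
  hf_mu_eq_zero_of_effective hD (axisRoomHF_of_axisRoom hR) (E_eq_zero_of_axisRoom hD h1 hR) h1 hP

/-- **THE SURPLUS DICHOTOMY.** In the relaxed axis room of a design with `E = 0` passing `HallPlusUp 8`, either the class measure has
NO positive class at all, or its positive classes cost rank with the surplus: `#{ω > 0} + 8 ≤ rank`.
(If some positive P-mass lies outside the union of the positive classes' threshold down-sets, the surplus cut applies; if none does,
`posCl_eq_empty_of_inside`.) -/
theorem posCl_empty_or_cost {h : ℤ} {D : Design} (hD : D.OnAlphabet h) (hR : AxisRoomHF D) (hE : E h D = 0) (hH8 : HallPlusUp D 8) :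
    posCl D = ∅ ∨ ((posCl D).card : ℤ) + 8 ≤ D.rank := by
  classical
  have hA : ∀ τ ∈ posCl D, 0 < omegaC D τ := fun τ hτ => mem_posCl.mp hτ
  -- thresholds of positive excess for the positive classes
  have ht : ∀ τ, ∃ s : ℤ, τ ∈ posCl D → 1 ≤ exc D τ s := fun τ =>
    if hτ : τ ∈ posCl D then (exists_exc_pos (hA τ hτ)).imp fun s hs _ => hs else ⟨0, fun h => absurd h hτ⟩
  choose t ht using ht
  by_cases hout : 0 < massOn D.P fun c => ¬ InClass (posCl D) t c
  · exact Or.inr (card_add_eight_le_rank_of_exc_pos hD hR hH8 (posCl D) t (fun τ hτ => ht τ hτ) hout)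
  · left
    have h0 : massOn D.P (fun c => ¬ InClass (posCl D) t c) = 0 := by
      have := Nat.eq_zero_or_pos (massOn D.P fun c => ¬ InClass (posCl D) t c); tauto
    exact posCl_eq_empty_of_inside hD hE t h0

/-- **THE LAW IN THE RELAXED ROOM**: hub-free support cells axis, `E = 0`, (A1), `HallPlusUp 8`, `rank ≤ γ + 8` with a corank-`γ`
phase-torus law ⇒ `μ = 0`.  (THE METHOD CEILING, typed: the kernel window for the torus threshold is `10 ≤ γ* ≤ 13` —
`phaseTorusLawN_ten`, `not_phaseTorusLawN_fourteen` — so this road ends at `rank ≤ 21` at best.) -/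
theorem hf_mu_eq_zero_of_law {h : ℤ} {D : Design} (hD : D.OnAlphabet h) (hR : AxisRoomHF D) (hE : E h D = 0) (h1 : D.A1)
    (hH8 : HallPlusUp D 8) {γ : ℕ} (hlaw : PhaseTorusLawN γ) (hr : D.rank ≤ γ + 8) : D.mu = 0 := by
  classical
  by_cases hc : (posCl D).card ≤ γ
  · exact mu_eq_zero_of_few_posClasses hD hR hE h1 hlaw (posCl D) hc not_mem_posCl
  rcases posCl_empty_or_cost hD hR hE hH8 with he | hcost
  · rw [he] at hc; simp at hc
  · exfalso
    have : ((γ : ℤ) + 1) ≤ (posCl D).card := by exact_mod_cast (show γ + 1 ≤ (posCl D).card by omega)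
    linarith

/-- **rank ≤ 18** in the relaxed room. -/
theorem hf_mu_eq_zero {h : ℤ} {D : Design} (hD : D.OnAlphabet h) (hR : AxisRoomHF D) (hE : E h D = 0) (h1 : D.A1)
    (hH8 : HallPlusUp D 8) (hr : D.rank ≤ 18) : D.mu = 0 :=
  hf_mu_eq_zero_of_law hD hR hE h1 hH8 phaseTorusLawN_ten (by simpa using hr)

/-- **THE AXIS-ROOM PHASE-TORUS LAW.** On the height-`h` alphabet (every `h`), a two-term design in the AXIS ROOM that is (A1)-clean and
passes the surplus-8 Hall condition `HallPlusUp 8` of the room of record has `μ = 0` as soon as `rank ≤ 18`.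
No budget, no `RuleD`, no `Disj`, no `HallUp`, no flow data. -/
theorem axisRoom_mu_eq_zero {h : ℤ} {D : Design} (hD : D.OnAlphabet h) (hR : AxisRoom D) (h1 : D.A1)
    (hH8 : HallPlusUp D 8) (hr : D.rank ≤ 18) : D.mu = 0 :=
  hf_mu_eq_zero hD (axisRoomHF_of_axisRoom hR) (E_eq_zero_of_axisRoom hD h1 hR) h1 hH8 hr

theorem axisRoom_mu_eq_zero_of_law {h : ℤ} {D : Design} (hD : D.OnAlphabet h) (hR : AxisRoom D) (h1 : D.A1)
    (hH8 : HallPlusUp D 8) {γ : ℕ} (hlaw : PhaseTorusLawN γ) (hr : D.rank ≤ γ + 8) : D.mu = 0 :=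
  hf_mu_eq_zero_of_law hD (axisRoomHF_of_axisRoom hR) (E_eq_zero_of_axisRoom hD h1 hR) h1 hH8 hlaw hr

/-- the contrapositive as a RANK FLOOR: an inhabitant of the door of record in the (relaxed) axis room has `rank ≥ 19`. -/
theorem hf_rank_ge_nineteen {h : ℤ} {D : Design} (hD : D.OnAlphabet h) (hR : AxisRoomHF D) (hE : E h D = 0) (h1 : D.A1)
    (hH8 : HallPlusUp D 8) (hμ : D.mu ≠ 0) : 19 ≤ D.rank := by
  by_contra hlt
  exact hμ (hf_mu_eq_zero hD hR hE h1 hH8 (by omega))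

theorem axisRoom_rank_ge_nineteen {h : ℤ} {D : Design} (hD : D.OnAlphabet h) (hR : AxisRoom D) (h1 : D.A1)
    (hH8 : HallPlusUp D 8) (hμ : D.mu ≠ 0) : 19 ≤ D.rank :=
  hf_rank_ge_nineteen hD (axisRoomHF_of_axisRoom hR) (E_eq_zero_of_axisRoom hD h1 hR) h1 hH8 hμ

/-- **THE SHAPE OF AN INHABITANT.** In the (relaxed) axis room of the door of record, `μ ≠ 0` forces at least ELEVEN positive classes,
at least ELEVEN negative classes, and `rank ≥ #{ω > 0} + 8 ≥ 19`. -/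
theorem hf_inhabitant_shape {h : ℤ} {D : Design} (hD : D.OnAlphabet h) (hR : AxisRoomHF D) (hE : E h D = 0) (h1 : D.A1)
    (hH8 : HallPlusUp D 8) (hμ : D.mu ≠ 0) :
    11 ≤ (posCl D).card ∧ 11 ≤ (negCl D).card ∧ ((posCl D).card : ℤ) + 8 ≤ D.rank := by
  classical
  have hpos : 11 ≤ (posCl D).card := by
    by_contra hc
    exact hμ (mu_eq_zero_of_few_posClasses hD hR hE h1 phaseTorusLawN_ten (posCl D) (by omega) not_mem_posCl)
  have hneg : 11 ≤ (negCl D).card := by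
    by_contra hc
    exact hμ (mu_eq_zero_of_few_negClasses hD hR hE h1 phaseTorusLawN_ten (negCl D) (by omega) not_mem_negCl)
  refine ⟨hpos, hneg, ?_⟩
  rcases posCl_empty_or_cost hD hR hE hH8 with he | hcost
  · rw [he] at hpos; simp at hpos
  · exact hcost

theorem axisRoom_inhabitant_shape {h : ℤ} {D : Design} (hD : D.OnAlphabet h) (hR : AxisRoom D) (h1 : D.A1)
    (hH8 : HallPlusUp D 8) (hμ : D.mu ≠ 0) :
    11 ≤ (posCl D).card ∧ 11 ≤ (negCl D).card ∧ ((posCl D).card : ℤ) + 8 ≤ D.rank :=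
  hf_inhabitant_shape hD (axisRoomHF_of_axisRoom hR) (E_eq_zero_of_axisRoom hD h1 hR) h1 hH8 hμ

/-- **the general count** exported for later shells: in the (relaxed) axis room, `#{τ : ω(τ) > 0} ≤ rank` under `HallUp`, and
`#{τ : ω(τ) > 0} + 8 ≤ rank` under `HallPlusUp 8` as soon as a supported P-cell carries a hub. -/
theorem axisRoom_posClasses {h : ℤ} {D : Design} (hD : D.OnAlphabet h) (hR : AxisRoomHF D) (hH : HallUp D) (hH8 : HallPlusUp D 8) :
    (((posCl D).card : ℤ) ≤ D.rank) ∧ ((∃ x ∈ D.suppP, ¬ HubFree x) → ((posCl D).card : ℤ) + 8 ≤ D.rank) := by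
  classical
  refine ⟨posClasses_card_le_rank hD hR hH _ (fun τ hτ => mem_posCl.mp hτ),
    fun hhub => posClasses_card_add_eight_le_rank hD hR hH8 _ (fun τ hτ => mem_posCl.mp hτ) hhub⟩

/-- **room-of-record reading (every shell, every budget)**: the `SPlusB` sentence restricted to the axis room holds up to rank 18 —
`∀ D, OnAlphabet h → Disj → A1 → RuleD → HallUp → HallPlusUp 8 → μ ≠ 0 → Budget → AxisRoom → rank ≤ 18 → False`. -/
theorem sPlusB_axisRoom_rank_le (h : ℤ) (Budget : Design → Prop) :
    ∀ D : Design, D.OnAlphabet h → LeggedFloor.Disj D → D.A1 → LeggedFloor.RuleD D → HallUp D → HallPlusUp D 8 → D.mu ≠ 0 →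
      Budget D → AxisRoom D → D.rank ≤ 18 → False :=
  fun _ hD _ h1 _ _ hH8 hμ _ hR hr => hμ (axisRoom_mu_eq_zero hD hR h1 hH8 hr)

/-- the same reading in the relaxed room with `E = 0` as the room datum. -/
theorem sPlusB_axisRoomHF_rank_le (h : ℤ) (Budget : Design → Prop) :
    ∀ D : Design, D.OnAlphabet h → LeggedFloor.Disj D → D.A1 → LeggedFloor.RuleD D → HallUp D → HallPlusUp D 8 → D.mu ≠ 0 →
      Budget D → AxisRoomHF D → E h D = 0 → D.rank ≤ 18 → False :=
  fun _ hD _ h1 _ _ hH8 hμ _ hR hE hr => hμ (hf_mu_eq_zero hD hR hE h1 hH8 hr)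

/-! ## §8 THE UP-CLOSED MIRROR: hub-bearing cells and LOWER class sets — P-hubs and lower P-excess cost hub N-mass -/

/-- the lower set of ONE class: hub-free cells of phase class `τ` with charge volume `≤ s`. -/
abbrev InClLow (τ : PT) (s : ℤ) (c : Cell) : Prop := HubFree c ∧ cphase c = τ ∧ V c ≤ s

/-- the hub-bearing cells together with the lower sets of a family of classes with thresholds `t`. -/
abbrev InLow (B : Finset PT) (t : PT → ℤ) (c : Cell) : Prop := ¬ HubFree c ∨ (cphase c ∈ B ∧ V c ≤ t (cphase c))

/-- **mirror of the slide lemma**: `InLow B t` is closed UPWARD along weak arrows (a weak arrow into a hub-free N-cell comes from a hub-free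
P-cell of the same class and larger volume; into a hub-bearing N-cell, anything goes — and hub-bearing cells are in the set). -/
theorem upClosedOn_inLow {h : ℤ} {D : Design} (hD : D.OnAlphabet h) (hR : AxisRoomHF D) (B : Finset PT) (t : PT → ℤ) :
    UpClosedOn D (InLow B t) := by
  intro x hx y hy hw hxU
  by_cases hyf : HubFree y
  · have hxf' := hubFree_of_weakLive (onAlphabet_of_memP hD hx) (onAlphabet_of_memN hD hy) hyf hw
    obtain ⟨hph, hle⟩ := slide_cell (onAlphabet_of_memP hD hx) (onAlphabet_of_memN hD hy)
      (hR x (List.mem_append_right _ hx) hxf') (hR y (List.mem_append_left _ hy) hyf) hyf hw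
    rcases hxU with hxf | ⟨hxB, hxt⟩
    · exact absurd hxf' hxf
    · right; rw [← hph]; exact ⟨hxB, le_trans (V_le_of_slide hle) hxt⟩
  · exact Or.inl hyf

/-- the mass of `InLow B t` splits into the hub-bearing mass and the class lower masses. -/
theorem massOn_inLow_eq (L : List (Cell × ℕ)) (B : Finset PT) (t : PT → ℤ) :
    massOn L (InLow B t) = massOn L (fun c => ¬ HubFree c) + ∑ τ ∈ B, massOn L (InClLow τ (t τ)) := by
  induction L with
  | nil => simp [massOn]
  | cons a l ih =>
    rw [massOn_cons, ih, massOn_cons, Finset.sum_congr rfl fun τ _ => massOn_cons a l (InClLow τ (t τ)), Finset.sum_add_distrib]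
    have key : (if InLow B t a.1 then a.2 else 0) =
        (if ¬ HubFree a.1 then a.2 else 0) + ∑ τ ∈ B, (if InClLow τ (t τ) a.1 then a.2 else 0) := by
      by_cases hf : HubFree a.1
      · rw [if_neg (not_not.mpr hf), zero_add]
        by_cases hB : cphase a.1 ∈ B
        · rw [← Finset.add_sum_erase B _ hB]
          have hrest : ∑ τ ∈ B.erase (cphase a.1), (if InClLow τ (t τ) a.1 then a.2 else 0) = 0 := by
            refine Finset.sum_eq_zero fun τ hτ => ?_
            rw [if_neg]
            rintro ⟨-, hph, -⟩
            exact (Finset.ne_of_mem_erase hτ) hph.symm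
          rw [hrest, add_zero]
          by_cases ht : V a.1 ≤ t (cphase a.1)
          · rw [if_pos (Or.inr ⟨hB, ht⟩), if_pos ⟨hf, rfl, ht⟩]
          · rw [if_neg, if_neg (fun h => ht h.2.2)]
            rintro (h | ⟨-, h⟩)
            exacts [h hf, ht h]
        · rw [if_neg]
          · symm
            refine Finset.sum_eq_zero fun τ hτ => ?_
            rw [if_neg]
            rintro ⟨-, hph, -⟩
            exact hB (hph ▸ hτ)
          · rintro (h | ⟨h, -⟩)
            exacts [h hf, hB h]
      · rw [if_pos (Or.inl hf), if_pos hf]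
        have : ∑ τ ∈ B, (if InClLow τ (t τ) a.1 then a.2 else 0) = 0 :=
          Finset.sum_eq_zero fun τ _ => by rw [if_neg (fun h => hf h.1)]
        rw [this, add_zero]
    rw [key]
    ring

/-- the LOWER EXCESS of a class at threshold `s`: `m(P_τ ∩ {V ≤ s}) − n(N_τ ∩ {V ≤ s})`. -/
def lexc (D : Design) (τ : PT) (s : ℤ) : ℤ := (massOn D.P (InClLow τ s) : ℤ) - massOn D.N (InClLow τ s)

/-- the hub-bearing P-mass and N-mass. -/
def hubP (D : Design) : ℕ := massOn D.P fun c => ¬ HubFree c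
def hubN (D : Design) : ℕ := massOn D.N fun c => ¬ HubFree c

/-- **THE MIRROR COUNT (HallUp)**: in the axis room, the lower P-excesses of ANY family of classes are paid for by hub-bearing N-mass:
`Σ_{τ∈B} lexc(τ,t_τ) ≤ hubN − hubP`. -/
theorem sum_lexc_le {h : ℤ} {D : Design} (hD : D.OnAlphabet h) (hR : AxisRoomHF D) (hH : HallUp D) (B : Finset PT) (t : PT → ℤ) :
    ∑ τ ∈ B, lexc D τ (t τ) ≤ (hubN D : ℤ) - hubP D := by
  have hcut := hallUp_cut_on D hH (InLow B t) (upClosedOn_inLow hD hR B t)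
  rw [massOn_inLow_eq, massOn_inLow_eq] at hcut
  unfold lexc hubN hubP
  have hz : ((massOn D.P (fun c => ¬ HubFree c) : ℕ) : ℤ) + ∑ τ ∈ B, (massOn D.P (InClLow τ (t τ)) : ℤ) ≤
      (massOn D.N (fun c => ¬ HubFree c) : ℤ) + ∑ τ ∈ B, (massOn D.N (InClLow τ (t τ)) : ℤ) := by exact_mod_cast hcut
  rw [Finset.sum_sub_distrib]
  linarith

/-- **THE MIRROR COUNT WITH SURPLUS (HallPlusUp 8)**: `Σ_{τ∈B} lexc(τ,t_τ) + 8 ≤ hubN − hubP` as soon as the up-set carries P-mass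
(a P-hub, or a P-cell in one of the lower sets). -/
theorem sum_lexc_add_eight_le {h : ℤ} {D : Design} (hD : D.OnAlphabet h) (hR : AxisRoomHF D) (hH8 : HallPlusUp D 8) (B : Finset PT)
    (t : PT → ℤ) (hpos : 0 < hubP D ∨ ∃ τ ∈ B, 0 < massOn D.P (InClLow τ (t τ))) :
    ∑ τ ∈ B, lexc D τ (t τ) + 8 ≤ (hubN D : ℤ) - hubP D := by
  have hposU : 0 < massOn D.P (InLow B t) := by
    rw [massOn_inLow_eq]
    rcases hpos with hp | ⟨τ, hτ, hp⟩
    · unfold hubP at hp; omega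
    · have := Finset.single_le_sum (fun τ' _ => Nat.zero_le (massOn D.P (InClLow τ' (t τ')))) hτ
      omega
  have hcut := hallPlusUp_cut_on D 8 hH8 (InLow B t) (upClosedOn_inLow hD hR B t) hposU
  rw [massOn_inLow_eq, massOn_inLow_eq] at hcut
  unfold lexc hubN hubP
  have hz : ((massOn D.P (fun c => ¬ HubFree c) : ℕ) : ℤ) + ∑ τ ∈ B, (massOn D.P (InClLow τ (t τ)) : ℤ) + 8 ≤
      (massOn D.N (fun c => ¬ HubFree c) : ℤ) + ∑ τ ∈ B, (massOn D.N (InClLow τ (t τ)) : ℤ) := by exact_mod_cast hcut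
  rw [Finset.sum_sub_distrib]
  linarith

/-- **P-HUBS COST N-HUBS**: `hubP ≤ hubN` under `HallUp`, and `hubP + 8 ≤ hubN` under `HallPlusUp 8` as soon as `hubP > 0`. -/
theorem hubP_le_hubN {h : ℤ} {D : Design} (hD : D.OnAlphabet h) (hR : AxisRoomHF D) (hH : HallUp D) : hubP D ≤ hubN D := by
  have := sum_lexc_le hD hR hH ∅ fun _ => 0
  rw [Finset.sum_empty] at this
  exact_mod_cast (by linarith : (hubP D : ℤ) ≤ hubN D)

theorem hubP_add_eight_le_hubN {h : ℤ} {D : Design} (hD : D.OnAlphabet h) (hR : AxisRoomHF D) (hH8 : HallPlusUp D 8)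
    (hp : 0 < hubP D) : hubP D + 8 ≤ hubN D := by
  have := sum_lexc_add_eight_le hD hR hH8 ∅ (fun _ => 0) (Or.inl hp)
  rw [Finset.sum_empty] at this
  exact_mod_cast (by linarith : (hubP D : ℤ) + 8 ≤ hubN D)

/-- **CLASSWISE LOWER DOMINATION WHEN THE N-SIDE IS HUB-FREE**: if no supported N-cell carries a hub then (`HallPlusUp 8`) no supported
P-cell carries one, and (`HallUp`) in every phase class the P-cells are dominated FROM BELOW by the N-cells:
`m(P_τ ∩ {V ≤ s}) ≤ n(N_τ ∩ {V ≤ s})` for every class `τ` and threshold `s`. -/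
theorem hubP_eq_zero_of_hubN_eq_zero {h : ℤ} {D : Design} (hD : D.OnAlphabet h) (hR : AxisRoomHF D) (hH8 : HallPlusUp D 8)
    (h0 : hubN D = 0) : hubP D = 0 := by
  by_contra hp
  have := hubP_add_eight_le_hubN hD hR hH8 (Nat.pos_of_ne_zero hp)
  omega

theorem lexc_nonpos_of_hubN_eq_zero {h : ℤ} {D : Design} (hD : D.OnAlphabet h) (hR : AxisRoomHF D) (hH : HallUp D)
    (h0 : hubN D = 0) (τ : PT) (s : ℤ) : lexc D τ s ≤ 0 := by
  have h1 := sum_lexc_le hD hR hH {τ} fun _ => s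
  rw [Finset.sum_singleton, h0] at h1
  have : (0 : ℤ) ≤ hubP D := by positivity
  push_cast at h1
  linarith

/-! ## §9 `E = 0` beyond the axis room: PAIR-AXIS rooms (the exact extent of the pair law's vanishing) -/

/-- a PAIR-AXIS room for the slot pair `(g, g')`: no support cell is off-axis at both `g` and `g'`. -/
def PairAxisRoom (g g' : Fin 4) (D : Design) : Prop := ∀ c ∈ D.suppN ++ D.suppP, (c g).isAxis ∨ (c g').isAxis

/-- the NEAR-AXIS room: at most one off-axis letter per support cell (every slot pair is pair-axis). -/
def NearAxisRoom (D : Design) : Prop := ∀ c ∈ D.suppN ++ D.suppP, ∀ g g' : Fin 4, g ≠ g' → (c g).isAxis ∨ (c g').isAxis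

theorem nearAxisRoom_of_axisRoom {D : Design} (hR : AxisRoom D) : NearAxisRoom D := fun c hc g _ _ => Or.inl (hR c hc g)

theorem pw_eq_zero_of_pairAxis {c : Cell} {g g' : Fin 4} (hc : (c g).isAxis ∨ (c g').isAxis) : pw g g' c = 0 := by
  unfold pw
  rcases hc with h0 | h0
  · rw [abs_mul_abs_eq_zero_of_isAxis h0, zero_mul]
  · rw [abs_mul_abs_eq_zero_of_isAxis h0, mul_zero]

/-- **`E = 0` IN EVERY PAIR-AXIS ROOM**: ONE slot pair never simultaneously off-axis on the support already forces `E_h(D) = 0` for an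
(A1)-clean design on the alphabet (pair law for that pair) — in particular in the near-axis room.  (`E = 0` is the entrance to the
two-sided cover regime of `RingTwoMassLaw`; the phase-torus dictionary of §6, however, needs the full axis room.) -/
theorem E_eq_zero_of_pairAxisRoom {h : ℤ} {D : Design} (hD : D.OnAlphabet h) (h1 : D.A1) {g g' : Fin 4} (hne : g ≠ g')
    (hR : PairAxisRoom g g' D) : E h D = 0 := by
  rw [pair_law_alphabet hD h1 hne,
    linZ_eq_zero_of_vanish D.N _ (fun cm hcm hpos =>
      pw_eq_zero_of_pairAxis (hR cm.1 (List.mem_append_left _ ((mem_suppN_iff D cm.1).mpr ⟨cm.2, hcm, hpos⟩)))),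
    linZ_eq_zero_of_vanish D.P _ (fun cm hcm hpos =>
      pw_eq_zero_of_pairAxis (hR cm.1 (List.mem_append_right _ ((mem_suppP_iff D cm.1).mpr ⟨cm.2, hcm, hpos⟩))))]
  simp

theorem E_eq_zero_of_nearAxisRoom {h : ℤ} {D : Design} (hD : D.OnAlphabet h) (h1 : D.A1) (hR : NearAxisRoom D) : E h D = 0 :=
  E_eq_zero_of_pairAxisRoom hD h1 (show (0 : Fin 4) ≠ 1 by decide) fun c hc => hR c hc 0 1 (by decide)

/-- **THE LAW IN THE PAIR-AXIS RELAXED ROOM**: hub-free support cells axis, ONE slot pair never doubly off-axis among the (hub-bearing)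
support cells, (A1), `HallPlusUp 8`, `rank ≤ 18` ⇒ `μ = 0` — every height, no budget. -/
theorem pairAxis_mu_eq_zero {h : ℤ} {D : Design} (hD : D.OnAlphabet h) (hR : AxisRoomHF D) {g g' : Fin 4} (hne : g ≠ g')
    (hPA : PairAxisRoom g g' D) (h1 : D.A1) (hH8 : HallPlusUp D 8) (hr : D.rank ≤ 18) : D.mu = 0 :=
  hf_mu_eq_zero hD hR (E_eq_zero_of_pairAxisRoom hD h1 hne hPA) h1 hH8 hr

theorem pairAxis_inhabitant_shape {h : ℤ} {D : Design} (hD : D.OnAlphabet h) (hR : AxisRoomHF D) {g g' : Fin 4} (hne : g ≠ g')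
    (hPA : PairAxisRoom g g' D) (h1 : D.A1) (hH8 : HallPlusUp D 8) (hμ : D.mu ≠ 0) :
    11 ≤ (posCl D).card ∧ 11 ≤ (negCl D).card ∧ ((posCl D).card : ℤ) + 8 ≤ D.rank :=
  hf_inhabitant_shape hD hR (E_eq_zero_of_pairAxisRoom hD h1 hne hPA) h1 hH8 hμ

end Summit.HodgeConjecture.HodgeConjecture.Cruxes.BlochSeedDiscOne.AxisPhaseTorus
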